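import Literature.MathematicalPhysics.QuantumFieldTheory.Balaban1983to89.B9Eq387QuadraticPartitionIMS
import Literature.MathematicalPhysics.QuantumFieldTheory.Balaban1983to89.B9Eq3100LeibnizCommutatorEtaFree
import Literature.MathematicalPhysics.QuantumFieldTheory.Balaban1983to89.B9Eq387ProductPartitionBondEnergy

/-!
# `Balaban1983to89.B9Eq387IMSLocalLettersLattice` — T. Bałaban, *Propagators for lattice gauge theories in a background field*, Commun. Math. Phys. **99**
# (1985) 389–434 [Balaban1985BackgroundPropagators] p. 408 «Σ_{□∈𝒟} h²_□ = 1», (3.87)–(3.89) p. 409, (3.100) p. 413, p. 414 «O(M⁻¹), or O(M⁻²)», with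
# [Balaban1984PropagatorsI] (1.118) p. 36: **THE LOCAL LETTERS OF THE IMS ASSEMBLY AT THE LATTICE — rows L3∕L4∕L6∕L7 of the instance ledger
# (`t4/ROUTES-NE9.md` v13.30–v13.32) JOINED: for a quadratic partition `Σ_j χ_j² = 1` sampled at one site per cell, its pointwise multipliers `χ_S^j`,
# `χ_E^j` as CLMs on the weighted carriers, and the local letters `T₁ = D_U` (covariant curl), `T₂ = D*_U` (covariant divergence) at `c = η⁻¹`:
# `Σ_j ‖T_i(χ_S^jA)‖² ≤ ‖T_iA‖² + (t_ik_i + a_i)‖A‖²` with ne9-leaf-04's `η`-FREE letters (`t₁k₁ + a₁ = 16d(1+M_T)M_T·Nℓ² + 8dM_T²·Nℓ²`,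
# `t₂k₂ + a₂ = 2d(1+M_T)M_T·Nℓ² + dM_T²·Nℓ²`), and for the tree's `C^{1,1}` partition `B5SmoothPartition.hS` with `Nℓ² = 64∕(M₀η)²` — the per-letter step of
# `B9Eq387IMSAssembly.ims_assembly_strong` INHABITED for `i = 1, 2`** (route R2′ STEP B8′ S-P7 of the pub-balaban NE9 chain)

statement-level skeleton of published theorems with citation tags; proofs where landed; nothing here is a claim about the Yang–Mills mass gap

CITATION HEADER (lean-in-tree rule).  Audit cell `pub-balaban`, sub-cell `t4`, BINDER row NE9; filed by NE9 formalisation-swarm LEAF PROVER 01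
(`b2b-balaban-t4-ne9-formalise-leaf-01`, gen 81) as the IMS porter's junction of three landed families: this lineage's (C) `B9Eq387QuadraticPartitionIMS`
((dn)∕(up) shapes) ∕ (D) `B9Eq387IMSAssembly` (the consumer), ne9-leaf-04 g76's `B9Eq3100LeibnizCommutatorCurl ∕ Div ∕ EtaFree` (the commutator sizes of
`D_U`, `D*_U` with cutoffs as pointwise maps — t4-ne9-idea-1 g95's (J-P-γ) dress, ne9-leaf-06 g66's `B9Eq311PointwiseMultipliers`), and this lineage's
kernel-9 port `B9Eq387ProductPartitionBondEnergy` (`Θ₂ ≤ 64∕M₀²` for `B5SmoothPartition.hS`).  t4-ne9-idea-1 g95 [NE9IDEA1-G95-WORDS] l.48953: «no partition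
needs constructing for the LATTICE INSTANCE of (D) … FIRST REFUSAL ne9-leaf-01 g81 (IMS porter: the lattice instance of (D) is where `Θ₂` is consumed)».
Sources READ: [B9] pp. 408–409, 413–414 in the held text (`paper:balaban1985-cmp99-background-propagators`, journal page = PDF page + 388); [B5′] (1.118)
p. 36 as quoted in the cell's `B5SmoothPartition` header.

THE PRINT (verbatim).  [B9] p. 408: *«We take the partition of unity {h_□} defined at the end of Sect. A in [4]. We have Σ_{□∈𝒟} h²_□ = 1.»*; p. 414
l.1–3: the commutators `[D*D, h]`, `[DD*, h]` *«are first order differential operators with coefficients determined by derivatives of the function h.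
They are of the order O(M⁻¹), or O(M⁻²), if considered on a proper scale.»*  Print localises through parametrices and random walks; the IMS bookkeeping is
the ROUTE's device (ROUTES-NE9 §L1.2 R2′ STEP B8′ S-P7); NOTHING of [B9] is asserted.

WHAT IS PROVED (sorry-free; 0 `def`; [folklore]; the cutoff maps are HYPOTHESISED CLMs acting pointwise — `∀ f x, WL2.equiv (S f) x = χ_j(π x)·WL2.equiv f x`,
their existence shown in §1; nothing is constructed as a definition — FREEZE (0)).
* §1 on any weighted carrier `WL2 𝕜 w V`, sampling map `π : X → Y`, real family `χ : J → Y → ℝ`: **`sum_comp_self_eq_one_of_pointwise`** (`Σ_jχ_j² = 1 ⇒ Σ_j S_j∘S_j = 1`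
  — (C)'s `hS`∕`hE`), **`inner_apply_eq_inner_apply_of_pointwise`** ((C)'s `hEsa`: real multipliers are self-adjoint), `exists_pointwise_clm` ∕ `exists_pointwise_clm_family` (non-vacuity: every real family, e.g. `B5SmoothPartition.hS`, HAS such CLMs).
* §2 **`sum_norm_sq_apply_localised_le`** — the (dn) letter for ONE local `T : S →L E` from the two commutator sizes in leaf-04's dress
  (`Σ_j‖χ_E^j(Tx) − T(χ_S^jx)‖² ≤ a‖x‖²`, `‖Tx‖·‖Σ_j ad_j(ad_jT)x‖ ≤ tk·‖x‖²` ⇒ `Σ_j‖T(χ_S^jx)‖² ≤ ‖Tx‖² + (tk + a)‖x‖²`, via (C) `sum_localised_le_norm_sq_add`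
  at `ad_jT := χ_E^j∘T − T∘χ_S^j`); **`norm_sq_apply_le_sum_localised`** — the (up) letter for the non-local `W` (via (C) `norm_sq_le_sum_localised_add`).
* §3 THE LATTICE: **`sum_norm_sq_covCurl_localised_le`** (`T₁ = covCurlL2K 𝕜 c₀ η⁻¹ R`, `χ_S^j` on bonds at `b₋`, `χ_E^j` on plaquettes at the base site;
  `Σ_j(χ_j(b₋) − χ_j(b₊))² ≤ Nℓ²η²`, `‖R(b)v‖ ≤ M_T‖v‖` ⇒ constant `16d(1+M_T)M_T·Nℓ² + 8dM_T²·Nℓ²`, NO `η`), **`sum_norm_sq_covDiv_localised_le`**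
  (`T₂ = covDivL2K`, `χ_0^j` on sites; `2d(1+M_T)M_T·Nℓ² + dM_T²·Nℓ²`) — leaf-04's `…EtaFree` theorems BY NAME through §2.
* §4 THE TREE's PARTITION `B5SmoothPartition.hS Pd M₀` (`1 ≤ M₀`, `M₀ ∣ P_i`, `2M₀ ≤ P_i`): `circAbs_bond_le_one`, **`sum_hS_bond_sq_le`** (`Θ₂ ≤ 64∕M₀² =
  64((M₀η)⁻¹)²η²` on every bond, from `B9Eq387ProductPartitionBondEnergy.sum_hS_sub_sq_le_of_neighbour`), **`sum_norm_sq_covCurl_localised_le_smooth`** ∕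
  **`sum_norm_sq_covDiv_localised_le_smooth`** — the two (dn) letters with `Nℓ² := 64∕(M₀η)²` (`M₀η = M` the physical cube side; d-free partition factor).
HONEST SCOPE.  Letters only (`M_T`, `M₀η` free); the third local letter `T₃ = √a·Q̃′` and the non-local `W`'s size `k_W` (the S-P5(b) knot: (A)(B) glue +
kernels 3∕4∕5∕6 ports) are NOT here; the strong local coercivity (loc) is Tier P's.  NOT NE9, NOT the route (cell pub-balaban: NE9 NOT PRINTED ∕ NOT PROVED;
«NE9 ⇐ the named binders»; row WALLED ON A MODEL (O-NE9-1; #5 UNRULED); spine PROVED 0∕9; rung (B)+1 on a finite T⁴ — NOT infinite volume, NOT mass gap, NOT Clay;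
HONEST DEPENDENCY: continuum YM on T⁴ ⇐ BetaPertH ∧ nine spine estimates (0/9 proved); BetaPertH ⇐ (D1) ∧ (D4) ∧ CAP+tail; G-an2-4 gates asym, D1 and NE2/3/4).
NEW file importing (C), leaf-04's `B9Eq3100LeibnizCommutatorEtaFree` and this lineage's `B9Eq387ProductPartitionBondEnergy`; nothing modified.  Net new
unproved facts: 0.
-/

noncomputable section

open scoped BigOperators InnerProductSpace ComplexConjugate

namespace Literature.MathematicalPhysics.QuantumFieldTheory.Balaban1983to89.B9Eq387IMSLocalLettersLattice

open B9Eq311L2Pairing (WL2)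

section Partition

variable {𝕜 : Type*} [RCLike 𝕜] {X Y : Type*} [Fintype X] {w : X → ℝ} [Fact (∀ x, 0 < w x)]
  {V : Type*} [NormedAddCommGroup V] [InnerProductSpace 𝕜 V]
  {J : Type*} (s : Finset J) (π : X → Y) (χ : J → Y → ℝ)

omit [Fintype X] [Fact (∀ x, 0 < w x)] in
/-- the identification commutes with finite sums, pointwise (private helper). [folklore] -/
private theorem equiv_sum (g : J → WL2 𝕜 w V) (x : X) :
    WL2.equiv 𝕜 w V (∑ j ∈ s, g j) x = ∑ j ∈ s, WL2.equiv 𝕜 w V (g j) x := by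
  have e := congrFun (map_sum (WL2.linearEquiv 𝕜 𝕜 w (V := V)) g s) x
  simp only [WL2.linearEquiv_apply, Finset.sum_apply] at e
  exact e

/-- **POINTWISE REAL MULTIPLIERS FROM A QUADRATIC PARTITION COMPOSE TO THE IDENTITY**: if `S_j` acts as `f ↦ χ_j(π x)·f(x)` and `Σ_j χ_j(y)² = 1`, then
`Σ_j S_j ∘ S_j = 1` — hypothesis `hS`∕`hE` of `B9Eq387QuadraticPartitionIMS` ([B9] p. 408 «Σ_{□∈𝒟} h²_□ = 1», sampled at ONE site per cell).
[cite: Balaban1985BackgroundPropagators, p.408; Balaban1984PropagatorsI, (1.118) p.36] -/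
theorem sum_comp_self_eq_one_of_pointwise (S : J → WL2 𝕜 w V →L[𝕜] WL2 𝕜 w V)
    (hS : ∀ j (f : WL2 𝕜 w V) (x : X), WL2.equiv 𝕜 w V (S j f) x = (χ j (π x) : 𝕜) • WL2.equiv 𝕜 w V f x)
    (hχ : ∀ y, ∑ j ∈ s, χ j y ^ 2 = 1) :
    ∑ j ∈ s, S j ∘L S j = 1 := by
  refine ContinuousLinearMap.ext fun f => ?_
  apply (WL2.equiv 𝕜 w V).injective
  funext x
  have e : (∑ j ∈ s, S j ∘L S j) f = ∑ j ∈ s, S j (S j f) := by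
    rw [FunLike.coe_sum, Finset.sum_apply]; rfl
  have h2 : ∑ j ∈ s, ((χ j (π x) : ℝ) : 𝕜) * ((χ j (π x) : ℝ) : 𝕜) = 1 := by
    have h := hχ (π x)
    simp only [sq] at h
    exact_mod_cast h
  rw [e, equiv_sum]
  simp only [hS, smul_smul, ← Finset.sum_smul, h2, one_smul]
  rfl

/-- **POINTWISE REAL MULTIPLIERS ARE SELF-ADJOINT** on the weighted carrier: `⟪S_j f, g⟫ = ⟪f, S_j g⟫` — hypothesis `hEsa` of
`B9Eq387QuadraticPartitionIMS`. [cite: Balaban1985BackgroundPropagators, (3.11) p.392, p.408] -/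
theorem inner_apply_eq_inner_apply_of_pointwise (S : WL2 𝕜 w V →L[𝕜] WL2 𝕜 w V) (σ : Y → ℝ)
    (hS : ∀ (f : WL2 𝕜 w V) (x : X), WL2.equiv 𝕜 w V (S f) x = (σ (π x) : 𝕜) • WL2.equiv 𝕜 w V f x) (f g : WL2 𝕜 w V) :
    ⟪S f, g⟫_𝕜 = ⟪f, S g⟫_𝕜 := by
  rw [WL2.inner_def, WL2.inner_def]
  refine Finset.sum_congr rfl fun x _ => ?_
  rw [hS, hS, inner_smul_left, inner_smul_right, RCLike.conj_ofReal]

variable [FiniteDimensional 𝕜 V] in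
/-- **SUCH MULTIPLIERS EXIST** (no definition minted: the map is built inside the proof from `LinearMap.pi` through `WL2.linearEquiv`).
[cite: Balaban1985BackgroundPropagators, (3.11) p.392, p.408] -/
theorem exists_pointwise_clm (σ : Y → ℝ) :
    ∃ S : WL2 𝕜 w V →L[𝕜] WL2 𝕜 w V, ∀ (f : WL2 𝕜 w V) (x : X), WL2.equiv 𝕜 w V (S f) x = (σ (π x) : 𝕜) • WL2.equiv 𝕜 w V f x := by
  refine ⟨LinearMap.toContinuousLinearMap ((WL2.linearEquiv 𝕜 𝕜 w).symm.toLinearMap ∘ₗ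
    (LinearMap.pi fun x => ((σ (π x) : ℝ) : 𝕜) • LinearMap.proj x) ∘ₗ (WL2.linearEquiv 𝕜 𝕜 w).toLinearMap), fun f x => ?_⟩
  rfl

variable [FiniteDimensional 𝕜 V] in
/-- **… AS A FAMILY**: for a family of real symbols `χ_j` there is a family of CLMs `S_j` acting pointwise by `χ_j ∘ π` — so the cutoff hypotheses of
§2–§4 (`hS`, `hE`, `h0`, `hχS`, `hχE`, `hχ0`) are inhabited for ANY real family, in particular for `B5SmoothPartition.hS`. [cite: Balaban1985BackgroundPropagators, (3.11) p.392, p.408] -/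
theorem exists_pointwise_clm_family :
    ∃ S : J → WL2 𝕜 w V →L[𝕜] WL2 𝕜 w V, ∀ j (f : WL2 𝕜 w V) (x : X), WL2.equiv 𝕜 w V (S j f) x = (χ j (π x) : 𝕜) • WL2.equiv 𝕜 w V f x :=
  ⟨fun j => Classical.choose (exists_pointwise_clm (w := w) (V := V) π (χ j)),
    fun j => Classical.choose_spec (exists_pointwise_clm (w := w) (V := V) π (χ j))⟩

end Partition

/-! ## §2 The (dn) letter of `B9Eq387IMSAssembly` for ONE local letter `T`, from leaf-04-shaped commutator sizes -/

section LocalLetter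

variable {𝕜 : Type*} [RCLike 𝕜] {X X' Y : Type*} [Fintype X] [Fintype X'] {w : X → ℝ} {w' : X' → ℝ} [Fact (∀ x, 0 < w x)]
  [Fact (∀ x, 0 < w' x)] {V : Type*} [NormedAddCommGroup V] [InnerProductSpace 𝕜 V]
  {J : Type*} (s : Finset J) (πS : X → Y) (πE : X' → Y) (χ : J → Y → ℝ)

/-- **THE (dn) LETTER FOR ONE LOCAL `T`**: pointwise real multipliers `χ_S^j` (sampled through `π_S`) and `χ_E^j` (through `π_E`) from ONE quadratic
partition `Σ_j χ_j² = 1`, a local letter `T : S →L E`, and the two commutator sizes in ne9-leaf-04's dress — the first-order square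
`Σ_j ‖χ_E^j(Tx) − T(χ_S^jx)‖² ≤ a‖x‖²` and the product `‖Tx‖·‖Σ_j (χ_E^j(χ_E^j(Tx) − T(χ_S^jx)) − (χ_E^j(T(χ_S^jx)) − T(χ_S^j(χ_S^jx))))‖ ≤ tk·‖x‖²` — give
`Σ_j ‖T(χ_S^j x)‖² ≤ ‖Tx‖² + (tk + a)‖x‖²`, the per-letter step of `B9Eq387IMSAssembly.ims_assembly_strong` (via (C) `sum_localised_le_norm_sq_add` at
`ad_j T := χ_E^j ∘ T − T ∘ χ_S^j`). [folklore] (IMS localisation) [cite: Balaban1985BackgroundPropagators, p.408, (3.87)–(3.89) p.409, (3.100)–(3.101) pp.413–414] -/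
theorem sum_norm_sq_apply_localised_le (χS : J → WL2 𝕜 w V →L[𝕜] WL2 𝕜 w V) (χE : J → WL2 𝕜 w' V →L[𝕜] WL2 𝕜 w' V)
    (hS : ∀ j (f : WL2 𝕜 w V) (x : X), WL2.equiv 𝕜 w V (χS j f) x = (χ j (πS x) : 𝕜) • WL2.equiv 𝕜 w V f x)
    (hE : ∀ j (g : WL2 𝕜 w' V) (x : X'), WL2.equiv 𝕜 w' V (χE j g) x = (χ j (πE x) : 𝕜) • WL2.equiv 𝕜 w' V g x)
    (hχ : ∀ y, ∑ j ∈ s, χ j y ^ 2 = 1) (T : WL2 𝕜 w V →L[𝕜] WL2 𝕜 w' V) {a tk : ℝ}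
    (hAD : ∀ x, ∑ j ∈ s, ‖χE j (T x) - T (χS j x)‖ ^ 2 ≤ a * ‖x‖ ^ 2)
    (hTK : ∀ x, ‖T x‖ * ‖∑ j ∈ s, ((χE j (χE j (T x) - T (χS j x))) - (χE j (T (χS j x)) - T (χS j (χS j x))))‖ ≤ tk * ‖x‖ ^ 2)
    (x : WL2 𝕜 w V) :
    ∑ j ∈ s, ‖T (χS j x)‖ ^ 2 ≤ ‖T x‖ ^ 2 + (tk + a) * ‖x‖ ^ 2 := by
  have hS1 := sum_comp_self_eq_one_of_pointwise s πS χ χS hS hχ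
  have hE1 := sum_comp_self_eq_one_of_pointwise s πE χ χE hE hχ
  have hEsa : ∀ j (y y' : WL2 𝕜 w' V), ⟪χE j y, y'⟫_𝕜 = ⟪y, χE j y'⟫_𝕜 := fun j y y' =>
    inner_apply_eq_inner_apply_of_pointwise πE (χE j) (χ j) (hE j) y y'
  have h := B9Eq387QuadraticPartitionIMS.sum_localised_le_norm_sq_add s χE χS (ad := fun j T => χE j ∘L T - T ∘L χS j)
    (fun _ _ => rfl) hS1 hE1 hEsa T (K := ∑ j ∈ s, (χE j ∘L (χE j ∘L T - T ∘L χS j) - (χE j ∘L T - T ∘L χS j) ∘L χS j)) rfl x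
  have hK : (∑ j ∈ s, (χE j ∘L (χE j ∘L T - T ∘L χS j) - (χE j ∘L T - T ∘L χS j) ∘L χS j)) x =
      ∑ j ∈ s, ((χE j (χE j (T x) - T (χS j x))) - (χE j (T (χS j x)) - T (χS j (χS j x)))) := by
    rw [FunLike.coe_sum, Finset.sum_apply]
    rfl
  have hAD' : ∑ j ∈ s, ‖(χE j ∘L T - T ∘L χS j) x‖ ^ 2 ≤ a * ‖x‖ ^ 2 := by simpa using hAD x
  rw [hK] at h
  linarith [hTK x]

/-- **THE (up) LETTER FOR THE NON-LOCAL `W`** in the same dress: `‖Wx‖² ≤ Σ_j ‖W(χ_S^j x)‖² + ‖Wx‖·‖Σ_j (χ_E^j(χ_E^j(Wx) − W(χ_S^jx)) − (χ_E^j(W(χ_S^jx)) −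
W(χ_S^j(χ_S^jx))))‖` — the shape (up) of `B9Eq387IMSAssembly.ims_assembly_strong`, whose double-commutator element is sized by the glue
(`B9Eq3101DoubleCommutatorBlockSchur.norm_sum_adad_le`). [folklore] (IMS localisation) [cite: Balaban1985BackgroundPropagators, p.408, (3.87)–(3.89) p.409, (3.101) p.414] -/
theorem norm_sq_apply_le_sum_localised (χS : J → WL2 𝕜 w V →L[𝕜] WL2 𝕜 w V) (χE : J → WL2 𝕜 w' V →L[𝕜] WL2 𝕜 w' V)
    (hS : ∀ j (f : WL2 𝕜 w V) (x : X), WL2.equiv 𝕜 w V (χS j f) x = (χ j (πS x) : 𝕜) • WL2.equiv 𝕜 w V f x)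
    (hE : ∀ j (g : WL2 𝕜 w' V) (x : X'), WL2.equiv 𝕜 w' V (χE j g) x = (χ j (πE x) : 𝕜) • WL2.equiv 𝕜 w' V g x)
    (hχ : ∀ y, ∑ j ∈ s, χ j y ^ 2 = 1) (W : WL2 𝕜 w V →L[𝕜] WL2 𝕜 w' V) (x : WL2 𝕜 w V) :
    ‖W x‖ ^ 2 ≤ ∑ j ∈ s, ‖W (χS j x)‖ ^ 2 +
      ‖W x‖ * ‖∑ j ∈ s, ((χE j (χE j (W x) - W (χS j x))) - (χE j (W (χS j x)) - W (χS j (χS j x))))‖ := by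
  have hS1 := sum_comp_self_eq_one_of_pointwise s πS χ χS hS hχ
  have hE1 := sum_comp_self_eq_one_of_pointwise s πE χ χE hE hχ
  have hEsa : ∀ j (y y' : WL2 𝕜 w' V), ⟪χE j y, y'⟫_𝕜 = ⟪y, χE j y'⟫_𝕜 := fun j y y' =>
    inner_apply_eq_inner_apply_of_pointwise πE (χE j) (χ j) (hE j) y y'
  have h := B9Eq387QuadraticPartitionIMS.norm_sq_le_sum_localised_add s χE χS (ad := fun j T => χE j ∘L T - T ∘L χS j)
    (fun _ _ => rfl) hS1 hE1 hEsa W (K := ∑ j ∈ s, (χE j ∘L (χE j ∘L W - W ∘L χS j) - (χE j ∘L W - W ∘L χS j) ∘L χS j)) rfl x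
  have hK : (∑ j ∈ s, (χE j ∘L (χE j ∘L W - W ∘L χS j) - (χE j ∘L W - W ∘L χS j) ∘L χS j)) x =
      ∑ j ∈ s, ((χE j (χE j (W x) - W (χS j x))) - (χE j (W (χS j x)) - W (χS j (χS j x)))) := by
    rw [FunLike.coe_sum, Finset.sum_apply]
    rfl
  rwa [hK] at h

end LocalLetter

/-! ## §3 THE LATTICE INSTANCES: `T₁ = D_U` (covariant curl) and `T₂ = D*_U` (covariant divergence) at `c = η⁻¹`, with ne9-leaf-04's `η`-free letters -/

section Lattice

open B9SectCLatticeCarrier (Bond Plaq bpos btgt)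
open B4Sect5Torus (TSite)
open B11Eq103H1Complex (SiteL2K BondL2K covDivL2K)
open B9Eq310HessianOperator (PlaqL2K covCurlL2K)
open B9Eq3100LeibnizCommutatorEtaFree (sum_norm_sq_comm_covCurlL2K_le_etaFree norm_mul_norm_sum_comm_comm_covCurlL2K_le_etaFree
  sum_norm_sq_comm_covDivL2K_le_etaFree norm_mul_norm_sum_comm_comm_covDivL2K_le_etaFree)

variable {𝕜 : Type*} [RCLike 𝕜] {d : ℕ} {Pd : Fin d → ℕ} {W : Type*} [NormedAddCommGroup W] [InnerProductSpace 𝕜 W] [FiniteDimensional 𝕜 W]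
  {c₀ : ℝ} [Fact (0 < c₀)] {R S : Bond d Pd → W →ₗ[𝕜] W} {MT η ℓ N : ℝ} {J : Type*}

/-- **ROW L3∕L6∕L7 AT THE LATTICE — THE (dn) LETTER OF `T₁ = D_U`**: for a quadratic partition `Σ_j χ_j(x)² = 1` on the sites with bond increments
`Σ_j (χ_j(b₋) − χ_j(b₊))² ≤ Nℓ²η²`, its one-site-sampled multipliers `χ_S^j` (bonds, at `b₋`) and `χ_E^j` (plaquettes, at the base site) as CLMs, transporters
`‖R(b)v‖ ≤ M_T‖v‖`, and every 1-form `A`: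
`Σ_j ‖D_U(χ_S^jA)‖² ≤ ‖D_UA‖² + (16d(1+M_T)M_T·Nℓ² + 8dM_T²·Nℓ²)·‖A‖²` — NO `η` (ne9-leaf-04's `…EtaFree` letters through §2). [folklore]
[cite: Balaban1985BackgroundPropagators, (3.100) p.413, p.414 «O(M⁻¹), or O(M⁻²)», p.408, (3.87)–(3.89) p.409] -/
theorem sum_norm_sq_covCurl_localised_le (hη : 0 < η) (hN : 0 ≤ N) (hMT : 0 ≤ MT) (hR : ∀ b v, ‖R b v‖ ≤ MT * ‖v‖)
    (s : Finset J) {χf : J → TSite d Pd → ℝ} (hχ1 : ∀ x, ∑ j ∈ s, χf j x ^ 2 = 1)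
    (hχ : ∀ b : Bond d Pd, ∑ j ∈ s, (χf j (bpos b) - χf j (btgt b)) ^ 2 ≤ N * ℓ ^ 2 * η ^ 2)
    (χS : J → BondL2K 𝕜 d Pd c₀ W →L[𝕜] BondL2K 𝕜 d Pd c₀ W) (χE : J → PlaqL2K 𝕜 d Pd c₀ W →L[𝕜] PlaqL2K 𝕜 d Pd c₀ W)
    (hS : ∀ j (A : BondL2K 𝕜 d Pd c₀ W) (b : Bond d Pd), WL2.equiv 𝕜 _ W (χS j A) b = (χf j (bpos b) : 𝕜) • WL2.equiv 𝕜 _ W A b)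
    (hE : ∀ j (G : PlaqL2K 𝕜 d Pd c₀ W) (p : Plaq d Pd), WL2.equiv 𝕜 _ W (χE j G) p = (χf j p.1 : 𝕜) • WL2.equiv 𝕜 _ W G p)
    (A : BondL2K 𝕜 d Pd c₀ W) :
    ∑ j ∈ s, ‖covCurlL2K 𝕜 c₀ ((η : 𝕜))⁻¹ R (χS j A)‖ ^ 2 ≤
      ‖covCurlL2K 𝕜 c₀ ((η : 𝕜))⁻¹ R A‖ ^ 2 + (16 * d * ((1 + MT) * MT * (N * ℓ ^ 2)) + 8 * d * MT ^ 2 * (N * ℓ ^ 2)) * ‖A‖ ^ 2 :=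
  sum_norm_sq_apply_localised_le s bpos Prod.fst χf χS χE hS hE hχ1 (LinearMap.toContinuousLinearMap (covCurlL2K 𝕜 c₀ ((η : 𝕜))⁻¹ R))
    (fun A => sum_norm_sq_comm_covCurlL2K_le_etaFree hη hN hR s hχ (fun j => χS j) (fun j => χE j) hS hE A)
    (fun A => norm_mul_norm_sum_comm_comm_covCurlL2K_le_etaFree hη hN hMT hR s hχ (fun j => χS j) (fun j => χE j) hS hE A) A

/-- **ROW L4∕L6∕L7 AT THE LATTICE — THE (dn) LETTER OF `T₂ = D*_U`**: same partition, `χ_S^j` on bonds (at `b₋`), `χ_0^j` on sites, transporters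
`‖S(b)v‖ ≤ M_T‖v‖`: `Σ_j ‖D*_U(χ_S^jA)‖² ≤ ‖D*_UA‖² + (2d(1+M_T)M_T·Nℓ² + dM_T²·Nℓ²)·‖A‖²` — NO `η`. [folklore]
[cite: Balaban1985BackgroundPropagators, (3.100) p.413, (3.8) p.392, p.414, p.408, (3.87)–(3.89) p.409] -/
theorem sum_norm_sq_covDiv_localised_le (hη : 0 < η) (hN : 0 ≤ N) (hMT : 0 ≤ MT) (hR : ∀ b v, ‖S b v‖ ≤ MT * ‖v‖)
    (s : Finset J) {χf : J → TSite d Pd → ℝ} (hχ1 : ∀ x, ∑ j ∈ s, χf j x ^ 2 = 1)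
    (hχ : ∀ b : Bond d Pd, ∑ j ∈ s, (χf j (bpos b) - χf j (btgt b)) ^ 2 ≤ N * ℓ ^ 2 * η ^ 2)
    (χS : J → BondL2K 𝕜 d Pd c₀ W →L[𝕜] BondL2K 𝕜 d Pd c₀ W) (χ0 : J → SiteL2K 𝕜 d Pd c₀ W →L[𝕜] SiteL2K 𝕜 d Pd c₀ W)
    (hS : ∀ j (A : BondL2K 𝕜 d Pd c₀ W) (b : Bond d Pd), WL2.equiv 𝕜 _ W (χS j A) b = (χf j (bpos b) : 𝕜) • WL2.equiv 𝕜 _ W A b)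
    (h0 : ∀ j (f : SiteL2K 𝕜 d Pd c₀ W) (y : TSite d Pd), WL2.equiv 𝕜 _ W (χ0 j f) y = (χf j y : 𝕜) • WL2.equiv 𝕜 _ W f y)
    (A : BondL2K 𝕜 d Pd c₀ W) :
    ∑ j ∈ s, ‖covDivL2K 𝕜 c₀ ((η : 𝕜))⁻¹ S (χS j A)‖ ^ 2 ≤
      ‖covDivL2K 𝕜 c₀ ((η : 𝕜))⁻¹ S A‖ ^ 2 + (2 * d * ((1 + MT) * MT * (N * ℓ ^ 2)) + d * MT ^ 2 * (N * ℓ ^ 2)) * ‖A‖ ^ 2 :=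
  sum_norm_sq_apply_localised_le s bpos id χf χS χ0 hS h0 hχ1 (LinearMap.toContinuousLinearMap (covDivL2K 𝕜 c₀ ((η : 𝕜))⁻¹ S))
    (fun A => sum_norm_sq_comm_covDivL2K_le_etaFree hη hR s hχ (fun j => χS j) (fun j => χ0 j) hS h0 A)
    (fun A => norm_mul_norm_sum_comm_comm_covDivL2K_le_etaFree hη hN hMT hR s hχ (fun j => χS j) (fun j => χ0 j) hS h0 A) A

end Lattice

/-! ## §4 THE TREE's PARTITION: `B5SmoothPartition.hS` inhabits the hypotheses with `Θ₂ = 64∕M₀²` (`B9Eq387ProductPartitionBondEnergy`) -/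

section Smooth

open B9SectCLatticeCarrier (Bond Plaq bpos btgt shift shift_apply_val shift_apply_ne)
open B4Sect5Torus (TSite)
open B4TorusKernel.MultiPeriod (circAbs circAbs_add_mul circAbs_le_abs)
open B5TorusCover (Ctr)
open B5SmoothPartition (hS sum_hS_sq)
open B9Eq387ProductPartitionBondEnergy (sum_hS_sub_sq_le_of_neighbour)
open B11Eq103H1Complex (SiteL2K BondL2K covDivL2K)
open B9Eq310HessianOperator (PlaqL2K covCurlL2K)

variable {d : ℕ} {Pd : Fin d → ℕ}

/-- a lattice bond has circular length `≤ 1` in its own direction: `dist(x_μ − (x+e_μ)_μ, P_μℤ) ≤ 1`. [folklore] [cite: Balaban1985Averaging, (1)–(2) p.17] -/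
theorem circAbs_bond_le_one (μ : Fin d) (hP : 1 ≤ Pd μ) (x : TSite d Pd) :
    (circAbs (Pd μ) (((x μ).val : ℤ) - (((shift μ x) μ).val : ℤ)) : ℝ) ≤ 1 := by
  have hrep : ((x μ).val : ℤ) - (((shift μ x) μ).val : ℤ) = -1 + (Pd μ : ℤ) * ((((x μ).val : ℤ) + 1) / (Pd μ : ℤ)) := by
    rw [shift_apply_val]
    have h := Int.emod_add_mul_ediv (((x μ).val : ℤ) + 1) (Pd μ : ℤ)
    push_cast
    linarith
  rw [hrep, circAbs_add_mul]
  have h1 := circAbs_le_abs hP (-1)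
  have h2 : |(-1 : ℤ)| = 1 := by norm_num
  exact_mod_cast h1.trans_eq h2

/-- **THE TREE's `C^{1,1}` PARTITION HAS BOND ENERGY `≤ 64∕M₀² = 64·((M₀η)⁻¹)²·η²` ON EVERY LATTICE BOND** (`B9Eq387ProductPartitionBondEnergy.sum_hS_sub_sq_le_of_neighbour`
at the pair `(b₋, b₊)`, written in ne9-leaf-04's `N·ℓ²·η²` form with `N := 64`, `ℓ := (M₀η)⁻¹`; `M₀η = M` the physical cube side).
[cite: Balaban1984PropagatorsI, (1.118) p.36; Balaban1985BackgroundPropagators, p.408, p.414] -/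
theorem sum_hS_bond_sq_le {M₀ : ℕ} (hM : 1 ≤ M₀) (hdiv : ∀ i, M₀ ∣ Pd i) (h2N : ∀ i, 2 * M₀ ≤ Pd i) {η : ℝ} (hη : 0 < η) (b : Bond d Pd) :
    ∑ z : Ctr Pd M₀, (hS Pd M₀ z (bpos b) - hS Pd M₀ z (btgt b)) ^ 2 ≤ 64 * ((M₀ : ℝ) * η)⁻¹ ^ 2 * η ^ 2 := by
  have hM0 : (0 : ℝ) < M₀ := by exact_mod_cast hM
  have hP : 1 ≤ Pd b.2 := by have := h2N b.2; omega
  have h := sum_hS_sub_sq_le_of_neighbour hM hdiv h2N (bpos b) (btgt b) b.2 (fun i hi => shift_apply_ne hi b.1)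
    (circAbs_bond_le_one b.2 hP b.1)
  refine h.trans_eq ?_
  field_simp

variable {𝕜 : Type*} [RCLike 𝕜] {W : Type*} [NormedAddCommGroup W] [InnerProductSpace 𝕜 W] [FiniteDimensional 𝕜 W]
  {c₀ : ℝ} [Fact (0 < c₀)] {R S : Bond d Pd → W →ₗ[𝕜] W} {MT η : ℝ}

/-- **ROW L3∕L6∕L7 FOR THE TREE's PARTITION**: with `B5SmoothPartition.hS Pd M₀` (`1 ≤ M₀`, `M₀ ∣ P_i`, `2M₀ ≤ P_i`) sampled at one site per cell,
`Σ_z ‖D_U(χ_S^zA)‖² ≤ ‖D_UA‖² + (16d(1+M_T)M_T + 8dM_T²)·64∕(M₀η)²·‖A‖²` — `d`-free in the partition factor, `η` only through the physical side `M₀η`.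
[cite: Balaban1985BackgroundPropagators, (3.100) p.413, p.414, p.408, (3.87)–(3.89) p.409; Balaban1984PropagatorsI, (1.118) p.36] -/
theorem sum_norm_sq_covCurl_localised_le_smooth {M₀ : ℕ} (hM : 1 ≤ M₀) (hdiv : ∀ i, M₀ ∣ Pd i) (h2N : ∀ i, 2 * M₀ ≤ Pd i)
    (hη : 0 < η) (hMT : 0 ≤ MT) (hR : ∀ b v, ‖R b v‖ ≤ MT * ‖v‖)
    (χS : Ctr Pd M₀ → BondL2K 𝕜 d Pd c₀ W →L[𝕜] BondL2K 𝕜 d Pd c₀ W) (χE : Ctr Pd M₀ → PlaqL2K 𝕜 d Pd c₀ W →L[𝕜] PlaqL2K 𝕜 d Pd c₀ W)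
    (hχS : ∀ z (A : BondL2K 𝕜 d Pd c₀ W) (b : Bond d Pd), WL2.equiv 𝕜 _ W (χS z A) b = (hS Pd M₀ z (bpos b) : 𝕜) • WL2.equiv 𝕜 _ W A b)
    (hχE : ∀ z (G : PlaqL2K 𝕜 d Pd c₀ W) (p : Plaq d Pd), WL2.equiv 𝕜 _ W (χE z G) p = (hS Pd M₀ z p.1 : 𝕜) • WL2.equiv 𝕜 _ W G p)
    (A : BondL2K 𝕜 d Pd c₀ W) :
    ∑ z : Ctr Pd M₀, ‖covCurlL2K 𝕜 c₀ ((η : 𝕜))⁻¹ R (χS z A)‖ ^ 2 ≤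
      ‖covCurlL2K 𝕜 c₀ ((η : 𝕜))⁻¹ R A‖ ^ 2 +
        (16 * d * ((1 + MT) * MT * (64 * ((M₀ : ℝ) * η)⁻¹ ^ 2)) + 8 * d * MT ^ 2 * (64 * ((M₀ : ℝ) * η)⁻¹ ^ 2)) * ‖A‖ ^ 2 :=
  sum_norm_sq_covCurl_localised_le hη (by norm_num) hMT hR Finset.univ (fun x => sum_hS_sq hM hdiv h2N x)
    (fun b => sum_hS_bond_sq_le hM hdiv h2N hη b) χS χE (fun z => hχS z) (fun z => hχE z) A

/-- **ROW L4∕L6∕L7 FOR THE TREE's PARTITION**: `Σ_z ‖D*_U(χ_S^zA)‖² ≤ ‖D*_UA‖² + (2d(1+M_T)M_T + dM_T²)·64∕(M₀η)²·‖A‖²`.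
[cite: Balaban1985BackgroundPropagators, (3.100) p.413, (3.8) p.392, p.414, p.408; Balaban1984PropagatorsI, (1.118) p.36] -/
theorem sum_norm_sq_covDiv_localised_le_smooth {M₀ : ℕ} (hM : 1 ≤ M₀) (hdiv : ∀ i, M₀ ∣ Pd i) (h2N : ∀ i, 2 * M₀ ≤ Pd i)
    (hη : 0 < η) (hMT : 0 ≤ MT) (hR : ∀ b v, ‖S b v‖ ≤ MT * ‖v‖)
    (χS : Ctr Pd M₀ → BondL2K 𝕜 d Pd c₀ W →L[𝕜] BondL2K 𝕜 d Pd c₀ W) (χ0 : Ctr Pd M₀ → SiteL2K 𝕜 d Pd c₀ W →L[𝕜] SiteL2K 𝕜 d Pd c₀ W)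
    (hχS : ∀ z (A : BondL2K 𝕜 d Pd c₀ W) (b : Bond d Pd), WL2.equiv 𝕜 _ W (χS z A) b = (hS Pd M₀ z (bpos b) : 𝕜) • WL2.equiv 𝕜 _ W A b)
    (hχ0 : ∀ z (f : SiteL2K 𝕜 d Pd c₀ W) (y : TSite d Pd), WL2.equiv 𝕜 _ W (χ0 z f) y = (hS Pd M₀ z y : 𝕜) • WL2.equiv 𝕜 _ W f y)
    (A : BondL2K 𝕜 d Pd c₀ W) :
    ∑ z : Ctr Pd M₀, ‖covDivL2K 𝕜 c₀ ((η : 𝕜))⁻¹ S (χS z A)‖ ^ 2 ≤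
      ‖covDivL2K 𝕜 c₀ ((η : 𝕜))⁻¹ S A‖ ^ 2 +
        (2 * d * ((1 + MT) * MT * (64 * ((M₀ : ℝ) * η)⁻¹ ^ 2)) + d * MT ^ 2 * (64 * ((M₀ : ℝ) * η)⁻¹ ^ 2)) * ‖A‖ ^ 2 :=
  sum_norm_sq_covDiv_localised_le hη (by norm_num) hMT hR Finset.univ (fun x => sum_hS_sq hM hdiv h2N x)
    (fun b => sum_hS_bond_sq_le hM hdiv h2N hη b) χS χ0 (fun z => hχS z) (fun z => hχ0 z) A

end Smooth

end Literature.MathematicalPhysics.QuantumFieldTheory.Balaban1983to89.B9Eq387IMSLocalLettersLattice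

end
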